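import Literature.Geometry.Lorentzian.TeukolskyRadialConjugation
import Literature.Geometry.Lorentzian.TeukolskyRadialSchrodingerForm
import Literature.Geometry.Lorentzian.TeukolskyHorizonNormalisedLimits
import Literature.Geometry.Lorentzian.TeukolskyInfinityNormalisedLimits
import Literature.Geometry.Lorentzian.TeukolskyRadialFluxInfinity
import Literature.Geometry.Lorentzian.KerrSurfaceGravity
import Literature.Geometry.Lorentzian.KerrTortoiseRadiusSurj
import HarnessLib

/-!
# The cone Green-kernel bound for the normalised Teukolsky pair from its tortoise-variable core,
# for a frequency regime that may depend on `Λ` (pointwise constants)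
(namespace `Literature.Geometry.Lorentzian.Kerr.Costa2019`.)

Companion of `TeukolskyRadialConjugation.lean` (`coneKernelBound_of_pos(_poly)`: WLOG `m > 0` for cone
kernel bounds under a regime `P M a ω m` invariant under `(ω, m) ↦ (−ω, −m)`) and of
`TeukolskyRadialSchrodingerForm.lean` (`Kerr.schrodingerForm`, `Kerr.wronskian_schrodingerForm`: the
passage `u = √(r² + a²)·R ∘ ρ` to Carter's equation `u″ + (ω² − V(ρ x))u = 0` along a tortoise radius
`ρ`). Here the two are assembled ONCE AND FOR ALL in the form the case-by-case kernel bounds of the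
near-extremal programme consume: the frequency regime is a predicate `P a ω m Λ` that may involve the
angular parameter `Λ` (Breitenlohner–Freedman sector conditions `(1 + θ₁)(2r₊ω)² ≤ Λ − 2amω`,
large-`Λ` conditions `Λ₀ < Λ`, threshold/superradiant conditions), and the constants are POINTWISE
(given `M, θ` and the constants `a₁, ε₀, C, N` of the core, the conclusion holds with
`a₂ = a₁ ⊔ M/2`, `ε₂ = ε₀ ⊓ a₂/(8M²)` and the same `C, N`):

* `coneKernelBound_of_pos_regime` — WLOG `0 < m` (conjugation `(ω, m, R) ↦ (−ω, −m, conj R)`; `Λ`,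
  admissibility, the cone, the normalisations, `|𝔚|` and — by hypothesis — `P` are invariant);
* `kernelBound_of_tortoise_core_regime` — the `R`-language bound
  `√(r²+a²)‖R_𝓗 r‖·√(r′²+a²)‖R_𝓘 r′‖ ≤ CΛ^Nκ^{-N}‖𝔚(r)‖` (`r₊ < r ≤ r′`, `r′ ≥ r₊ + θ(r₊ − r₋)`, `m ≠ 0`,
  cone `|ω − mω₊| ≤ ε₂|m|`, regime `P a ω m Λ`) from the same two-point bound in Carter's tortoise
  variable for solutions of `u″ + (ω² − V(ρ x))u = 0` with the horizon data `‖u_𝓗‖ → 1`,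
  `‖u_𝓗′‖ → |ω − mω₊|`, `Im(ū_𝓗 u_𝓗′) ≡ −(ω − mω₊)` at `−∞`, the infinity data `‖u_𝓘‖ → 1`,
  `‖u_𝓘′‖ → |ω|`, `Im(ū_𝓘 u_𝓘′) ≡ ω` at `+∞`, and `0 < m`: the cone stays away from `ω = 0` once
  `ε₂ ≤ a₂/(8M²)` (`abs_omega_lower_of_cone`), a tortoise radius exists and is a strictly increasing
  surjection onto `(r₊, ∞)`, the end data are `tendsto_norm_(deriv_)horizon/infinitySolution` along
  `ρ`, the fluxes `Im(ū u′) = Δ·Im(R̄ R′)` are `radialFlux_eq_of_normalisedHorizon/Infinity`, and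
  `u_𝓗 u_𝓘′ − u_𝓘 u_𝓗′ = 𝔚` (`Kerr.wronskian_schrodingerForm`).

Pure plumbing (no estimate is proved here); the `Λ`-free, `∀M ∃constants` form of the same plumbing
is the crux-side `stub_polyPlumbing` of the near-extremal Kerr programme.

## References
* R. Teixeira da Costa, CMP 378 (2020) = arXiv:1910.02854, Def. 2.3, §2.4.1, Prop. 2.20 (key `Costa2019`).
* M. Dafermos, I. Rodnianski, Y. Shlapentokh-Rothman, arXiv:1402.7034, §§2.1.2, 4.2, 5.2.3
  (key `DafermosRodnianskiShlapentokhrothman2014`). The assembly is folklore.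
-/

noncomputable section

open Filter Set Complex
open scoped Topology ComplexConjugate

namespace Literature.Geometry.Lorentzian.Kerr

namespace Costa2019

/-! ### WLOG `0 < m` for a `Λ`-dependent regime -/

-- adapted from Literature/Geometry/Lorentzian/TeukolskyRadialConjugation.lean (`coneKernelBound_of_pos_poly`)
/-- **WLOG `0 < m`, pointwise constants, `Λ`-dependent regime.** Fix `M`, `θ`, constants
`a₁, ε₀, C, N` and a regime `P a ω m Λ` invariant under `(ω, m) ↦ (−ω, −m)`. If the kernel bound
`√(r²+a²)|R_𝓗(r)|·√(r′²+a²)|R_𝓘(r′)| ≤ CΛ^Nκ^{-N}|𝔚(r)|` holds for the normalised pair for all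
`a₁ ≤ |a| < M`, admissible `(ω, m, Λ)` with `0 < m` in the cone `|ω − mω₊| ≤ ε₀|m|` satisfying `P`,
then it holds for all `m ≠ 0` (same constants): for `m < 0` apply it to
`(−ω, −m, Λ, conj R_𝓗, conj R_𝓘)`. [cite: Costa2019, §2.4.1] -/
theorem coneKernelBound_of_pos_regime {M θ a₁ ε₀ C : ℝ} {N : ℕ} (P : ℝ → ℝ → ℤ → ℝ → Prop)
    (hP : ∀ a ω m Λ, P a ω m Λ → P a (-ω) (-m) Λ)
    (h : ∀ a : ℝ, a₁ ≤ |a| → IsSubextremal M a →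
        ∀ (ω : ℝ) (m : ℤ) (Λ : ℝ), IsAdmissibleTriple a ω m Λ → 0 < m →
          |ω - m * horizonAngularVelocity M a| ≤ ε₀ * |(m : ℝ)| → P a ω m Λ →
            ∀ RH RI : ℝ → ℂ,
              IsRadialTeukolskySolution M a 0 ω m (Λ - a ^ 2 * ω ^ 2) RH →
              IsNormalisedHorizonSolution M a 0 ω m RH →
              IsRadialTeukolskySolution M a 0 ω m (Λ - a ^ 2 * ω ^ 2) RI →
              IsNormalisedInfinitySolution M 0 ω RI →
                ∀ r r' : ℝ, rPlus M a < r → r ≤ r' →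
                  rPlus M a + θ * (rPlus M a - rMinus M a) ≤ r' →
                    Real.sqrt (r ^ 2 + a ^ 2) * ‖RH r‖ * (Real.sqrt (r' ^ 2 + a ^ 2) * ‖RI r'‖) ≤
                      C * Λ ^ N * (surfaceGravity M a)⁻¹ ^ N * ‖radialWronskian M a 0 RH RI r‖) :
    ∀ a : ℝ, a₁ ≤ |a| → IsSubextremal M a →
        ∀ (ω : ℝ) (m : ℤ) (Λ : ℝ), IsAdmissibleTriple a ω m Λ → m ≠ 0 →
          |ω - m * horizonAngularVelocity M a| ≤ ε₀ * |(m : ℝ)| → P a ω m Λ →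
            ∀ RH RI : ℝ → ℂ,
              IsRadialTeukolskySolution M a 0 ω m (Λ - a ^ 2 * ω ^ 2) RH →
              IsNormalisedHorizonSolution M a 0 ω m RH →
              IsRadialTeukolskySolution M a 0 ω m (Λ - a ^ 2 * ω ^ 2) RI →
              IsNormalisedInfinitySolution M 0 ω RI →
                ∀ r r' : ℝ, rPlus M a < r → r ≤ r' →
                  rPlus M a + θ * (rPlus M a - rMinus M a) ≤ r' →
                    Real.sqrt (r ^ 2 + a ^ 2) * ‖RH r‖ * (Real.sqrt (r' ^ 2 + a ^ 2) * ‖RI r'‖) ≤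
                      C * Λ ^ N * (surfaceGravity M a)⁻¹ ^ N * ‖radialWronskian M a 0 RH RI r‖ := by
  intro a ha hsub ω m Λ hadm hm hcone hPm RH RI hRH hnH hRI hnI r r' hr hrr' hr'
  rcases lt_or_gt_of_ne hm with hneg | hpos
  · -- `m < 0`: conjugate and flip the signs of `(ω, m)`; `Λ` is unchanged
    have hm' : (0 : ℤ) < -m := neg_pos.2 hneg
    have hadm' : IsAdmissibleTriple a (-ω) (-m) Λ := isAdmissibleTriple_neg_neg_iff.2 hadm
    have hcone' : |-ω - ((-m : ℤ) : ℝ) * horizonAngularVelocity M a| ≤ ε₀ * |((-m : ℤ) : ℝ)| := by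
      have e : -ω - ((-m : ℤ) : ℝ) * horizonAngularVelocity M a =
          -(ω - m * horizonAngularVelocity M a) := by
        push_cast; ring
      rw [e, abs_neg, Int.cast_neg, abs_neg]
      exact hcone
    have hRH' : IsRadialTeukolskySolution M a 0 (-ω) ((-m : ℤ) : ℝ) (Λ - a ^ 2 * (-ω) ^ 2)
        (fun y => conj (RH y)) := by
      rw [Int.cast_neg, isRadialTeukolskySolution_neg_neg_iff, neg_sq]
      exact isRadialTeukolskySolution_conj hRH
    have hnH' : IsNormalisedHorizonSolution M a 0 (-ω) ((-m : ℤ) : ℝ) (fun y => conj (RH y)) := by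
      rw [Int.cast_neg]
      exact isNormalisedHorizonSolution_conj_neg hnH
    have hRI' : IsRadialTeukolskySolution M a 0 (-ω) ((-m : ℤ) : ℝ) (Λ - a ^ 2 * (-ω) ^ 2)
        (fun y => conj (RI y)) := by
      rw [Int.cast_neg, isRadialTeukolskySolution_neg_neg_iff, neg_sq]
      exact isRadialTeukolskySolution_conj hRI
    have hnI' : IsNormalisedInfinitySolution M 0 (-ω) (fun y => conj (RI y)) :=
      isNormalisedInfinitySolution_conj_neg hnI
    have key := h a ha hsub (-ω) (-m) Λ hadm' hm' hcone' (hP a ω m Λ hPm) _ _ hRH' hnH' hRI'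
      hnI' r r' hr hrr' hr'
    obtain ⟨RH₁, RH₂, hdH⟩ := hRH
    obtain ⟨RI₁, RI₂, hdI⟩ := hRI
    rw [radialWronskian_conj (hdH r hr).1.differentiableAt (hdI r hr).1.differentiableAt] at key
    simpa only [Complex.norm_conj] using key
  · exact h a ha hsub ω m Λ hadm hpos hcone hPm RH RI hRH hnH hRI hnI r r' hr hrr' hr'

/-! ### Shrinking the cone so that `ω ≠ 0` -/

-- adapted from Summits/FinalStateConjecture/FinalStateConjecture/Theorems/PhaseMixingCaptureKappaExplicitWaveDecayPolyPlumbing.lean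
/-- **Shrinking the cone constants so that `ω ≠ 0`.** Given `a₁ < M`, `ε₀ > 0` (`M > 0`), the
constants `a₂ = a₁ ⊔ M/2 < M` and `ε₂ = ε₀ ⊓ a₂/(8M²) > 0` satisfy `a₁ ≤ a₂`, `ε₂ ≤ ε₀`, and every
`ω` with `|ω − mω₊| ≤ ε₂|m|`, `m ≠ 0`, `a₂ ≤ |a|` is non-zero (`abs_omega_lower_of_cone`). [folklore] -/
theorem cone_constants_omega_ne_zero {M a₁ ε₀ : ℝ} (hM : 0 < M) (ha₁ : a₁ < M) (hε₀ : 0 < ε₀) :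
    ∃ a₂ ε₂ : ℝ, a₂ < M ∧ 0 < ε₂ ∧ a₁ ≤ a₂ ∧ ε₂ ≤ ε₀ ∧
      ∀ (a ω : ℝ) (m : ℤ), a₂ ≤ |a| → m ≠ 0 →
        |ω - m * horizonAngularVelocity M a| ≤ ε₂ * |(m : ℝ)| → ω ≠ 0 := by
  have hpos : 0 < max a₁ (M / 2) := lt_max_of_lt_right (half_pos hM)
  refine ⟨max a₁ (M / 2), min ε₀ (max a₁ (M / 2) / (8 * M ^ 2)), max_lt ha₁ (by linarith),
    lt_min hε₀ (by positivity), le_max_left _ _, min_le_left _ _, fun a ω m ha hm hcone ↦ ?_⟩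
  have h1 := abs_omega_lower_of_cone hM hpos ha hcone
  have hμ : (1 : ℝ) ≤ |(m : ℝ)| := by exact_mod_cast Int.one_le_abs hm
  have h2 : min ε₀ (max a₁ (M / 2) / (8 * M ^ 2)) ≤ max a₁ (M / 2) / (8 * M ^ 2) :=
    min_le_right _ _
  have h3 : max a₁ (M / 2) / (4 * M ^ 2) = 2 * (max a₁ (M / 2) / (8 * M ^ 2)) := by ring
  have h4 : 0 < max a₁ (M / 2) / (8 * M ^ 2) := by positivity
  have h5 : max a₁ (M / 2) / (8 * M ^ 2) ≤ |ω| := by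
    calc max a₁ (M / 2) / (8 * M ^ 2) = max a₁ (M / 2) / (8 * M ^ 2) * 1 := (mul_one _).symm
      _ ≤ (max a₁ (M / 2) / (4 * M ^ 2) - min ε₀ (max a₁ (M / 2) / (8 * M ^ 2))) * |(m : ℝ)| :=
          mul_le_mul (by linarith) hμ zero_le_one (by linarith)
      _ ≤ |ω| := h1
  exact abs_pos.mp (h4.trans_le h5)

/-! ### The weight `S = √(r² + a²)` and the flux `Im(ū u′) = Δ·Im(R̄ R′)` -/

/-- `‖√(r² + a²) · z‖ = √(r² + a²) · ‖z‖`. [folklore] -/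
theorem norm_sqrt_weight_mul (a r : ℝ) (z : ℂ) :
    ‖((Real.sqrt (r ^ 2 + a ^ 2) : ℝ) : ℂ) * z‖ = Real.sqrt (r ^ 2 + a ^ 2) * ‖z‖ := by
  rw [norm_mul, Complex.norm_of_nonneg (Real.sqrt_nonneg _)]

-- adapted from Literature/Geometry/Lorentzian/TeukolskyHorizonNormalisedLimits.lean
/-- `d/ds (s² + a²)^{1/2} = s/(s² + a²)^{1/2}` at a point `y` with `y² + a² > 0`. [folklore] -/
private theorem hasDerivAt_weight {a y : ℝ} (hy : 0 < y ^ 2 + a ^ 2) :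
    HasDerivAt (fun s : ℝ ↦ Real.sqrt (s ^ 2 + a ^ 2)) (y / Real.sqrt (y ^ 2 + a ^ 2)) y := by
  have h1 : HasDerivAt (fun s : ℝ ↦ s ^ 2 + a ^ 2) (2 * y) y := by
    simpa using (hasDerivAt_pow 2 y).add_const (a ^ 2)
  refine (h1.sqrt hy.ne').congr_deriv ?_
  rw [mul_div_mul_left _ _ (two_ne_zero' ℝ)]

/-- The algebra of the flux in the weighted variable: for real `S`, `S′`, `D` and complex `z`, `w`,
`Im( conj(S z) · D (S′ z + S w) ) = D S² · Im(z̄ w)`. [folklore] -/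
private theorem im_conj_weight_mul (S S' D : ℝ) (z w : ℂ) :
    (conj ((S : ℂ) * z) * ((D : ℂ) * ((S' : ℂ) * z + (S : ℂ) * w))).im =
      D * S ^ 2 * (conj z * w).im := by
  simp only [Complex.mul_im, Complex.mul_re, Complex.add_re, Complex.add_im, map_mul,
    Complex.conj_ofReal, Complex.conj_re, Complex.conj_im, Complex.ofReal_re, Complex.ofReal_im]
  ring

/-- **`Im(ū u₁) = D·(r² + a²)·Im(R̄ R′)`** for `u = √(r² + a²) R` and
`u₁ = D · d/dr[√(r² + a²) R]` at a point `r` where `R` is differentiable (`r² + a² > 0`).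
[folklore] -/
theorem im_conj_weight_mul_deriv (a D : ℝ) {R : ℝ → ℂ} {r : ℝ} (hA : 0 < r ^ 2 + a ^ 2)
    (hR : DifferentiableAt ℝ R r) :
    (conj (((Real.sqrt (r ^ 2 + a ^ 2) : ℝ) : ℂ) * R r) *
        (((D : ℝ) : ℂ) *
          deriv (fun s : ℝ ↦ ((Real.sqrt (s ^ 2 + a ^ 2) : ℝ) : ℂ) * R s) r)).im =
      D * (r ^ 2 + a ^ 2) * (conj (R r) * deriv R r).im := by
  rw [((hasDerivAt_weight hA).ofReal_comp.fun_mul hR.hasDerivAt).deriv, im_conj_weight_mul,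
    Real.sq_sqrt hA.le]

/-! ### Carter's equation for `u = √(ρ² + a²)·R ∘ ρ` and the end data -/

/-- **Carter's equation along a tortoise radius**: for a classical solution `R` of the scalar radial
Teukolsky ODE (`λ = Λ − a²ω²`) and a tortoise radius `ρ`, `u = √(ρ² + a²)·R ∘ ρ` has a derivative
`u₁` on `ℝ` with `u₁′ = −(ω² − V(ρ x)) u`, and `u₁ = (Δ/(r² + a²))·d/dr[√(r² + a²) R]` at `r = ρ x`
(`Kerr.schrodingerForm`). [cite: DafermosRodnianskiShlapentokhrothman2014, §5.2.3] -/
theorem carter_equation_of_radial {M a ω Λ : ℝ} {m : ℤ} (hM : 0 < M) (ha : |a| < M) {R : ℝ → ℂ}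
    (hR : IsRadialTeukolskySolution M a 0 ω m (Λ - a ^ 2 * ω ^ 2) R) {ρ : ℝ → ℝ}
    (hρ : IsTortoiseRadius M a ρ) :
    ∃ u₁ : ℝ → ℂ,
      (∀ x, HasDerivAt (fun y ↦ ((Real.sqrt (ρ y ^ 2 + a ^ 2) : ℝ) : ℂ) * R (ρ y)) (u₁ x) x ∧
        HasDerivAt u₁ (-(((ω ^ 2 - sepPotential M a ω m Λ (ρ x) : ℝ) : ℂ) *
          (((Real.sqrt (ρ x ^ 2 + a ^ 2) : ℝ) : ℂ) * R (ρ x)))) x) ∧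
      ∀ x, u₁ x = ((delta M a (ρ x) / (ρ x ^ 2 + a ^ 2) : ℝ) : ℂ) *
          deriv (fun r : ℝ ↦ ((Real.sqrt (r ^ 2 + a ^ 2) : ℝ) : ℂ) * R r) (ρ x) := by
  obtain ⟨u₁, u₂, h⟩ := schrodingerForm hM ha hR hρ
  refine ⟨u₁, fun x ↦ ⟨(h x).1, ?_⟩, fun x ↦ (h x).2.2.2⟩
  obtain ⟨-, h2, h3, -⟩ := h x
  rwa [eq_neg_of_add_eq_zero_left h3] at h2

/-- **Horizon data of `u_𝓗 = √(ρ² + a²)·R_𝓗 ∘ ρ`**: `‖u_𝓗 x‖ → 1`, `‖u₁ x‖ → |ω − mω₊|` as `x → −∞`,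
and the flux `Im(ū_𝓗 u₁) ≡ −(ω − mω₊)`. [cite: Costa2019, Definition 2.3] -/
theorem horizon_data_of_radial {M a ω m lam : ℝ} (hM : 0 < M) (hsub : IsSubextremal M a)
    {R : ℝ → ℂ} (hR : IsRadialTeukolskySolution M a 0 ω m lam R)
    (hn : IsNormalisedHorizonSolution M a 0 ω m R) {ρ : ℝ → ℝ}
    (hρ : IsTortoiseRadius M a ρ) {u₁ : ℝ → ℂ}
    (hu₁ : ∀ x, u₁ x = ((delta M a (ρ x) / (ρ x ^ 2 + a ^ 2) : ℝ) : ℂ) *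
      deriv (fun r : ℝ ↦ ((Real.sqrt (r ^ 2 + a ^ 2) : ℝ) : ℂ) * R r) (ρ x)) :
    Tendsto (fun x ↦ ‖((Real.sqrt (ρ x ^ 2 + a ^ 2) : ℝ) : ℂ) * R (ρ x)‖) atBot (𝓝 1) ∧
    Tendsto (fun x ↦ ‖u₁ x‖) atBot (𝓝 |ω - m * horizonAngularVelocity M a|) ∧
    ∀ x, (conj (((Real.sqrt (ρ x ^ 2 + a ^ 2) : ℝ) : ℂ) * R (ρ x)) * u₁ x).im =
      -(ω - m * horizonAngularVelocity M a) := by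
  have ha : |a| < M := hsub
  have hbot := hρ.tendsto_nhdsGT
  refine ⟨?_, ?_, fun x ↦ ?_⟩
  · have h : Tendsto (fun x ↦ Real.sqrt (ρ x ^ 2 + a ^ 2) * ‖R (ρ x)‖) atBot (𝓝 1) :=
      (tendsto_norm_horizonSolution hn).comp hbot
    exact h.congr fun x ↦ (norm_sqrt_weight_mul a (ρ x) (R (ρ x))).symm
  · have h : Tendsto (fun x ↦ delta M a (ρ x) / (ρ x ^ 2 + a ^ 2) *
        ‖deriv (fun s : ℝ ↦ ((Real.sqrt (s ^ 2 + a ^ 2) : ℝ) : ℂ) * R s) (ρ x)‖) atBot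
        (𝓝 |ω - m * horizonAngularVelocity M a|) :=
      (tendsto_norm_deriv_horizonSolution hM ha hn).comp hbot
    refine h.congr fun x ↦ ?_
    rw [hu₁ x, norm_mul, Complex.norm_of_nonneg (hρ.deriv_pos hsub x).le]
  · obtain ⟨R', R'', hd⟩ := id hR
    have hr := hρ.rPlus_lt x
    have hA := hρ.sq_add_sq_pos hsub x
    rw [hu₁ x, im_conj_weight_mul_deriv a _ hA (hd _ hr).1.differentiableAt,
      div_mul_cancel₀ _ hA.ne', radialFlux_eq_of_normalisedHorizon ha hR hn hr]

/-- **Infinity data of `u_𝓘 = √(ρ² + a²)·R_𝓘 ∘ ρ`** (`ω ≠ 0`): `‖u_𝓘 x‖ → 1`, `‖u₁ x‖ → |ω|` as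
`x → +∞`, and the flux `Im(ū_𝓘 u₁) ≡ ω`. [cite: Costa2019, Definition 2.3] -/
theorem infinity_data_of_radial {M a ω m lam : ℝ} (hM : 0 < M) (hsub : IsSubextremal M a)
    (hω : ω ≠ 0) {R : ℝ → ℂ} (hR : IsRadialTeukolskySolution M a 0 ω m lam R)
    (hn : IsNormalisedInfinitySolution M 0 ω R) {ρ : ℝ → ℝ}
    (hρ : IsTortoiseRadius M a ρ) {u₁ : ℝ → ℂ}
    (hu₁ : ∀ x, u₁ x = ((delta M a (ρ x) / (ρ x ^ 2 + a ^ 2) : ℝ) : ℂ) *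
      deriv (fun r : ℝ ↦ ((Real.sqrt (r ^ 2 + a ^ 2) : ℝ) : ℂ) * R r) (ρ x)) :
    Tendsto (fun x ↦ ‖((Real.sqrt (ρ x ^ 2 + a ^ 2) : ℝ) : ℂ) * R (ρ x)‖) atTop (𝓝 1) ∧
    Tendsto (fun x ↦ ‖u₁ x‖) atTop (𝓝 |ω|) ∧
    ∀ x, (conj (((Real.sqrt (ρ x ^ 2 + a ^ 2) : ℝ) : ℂ) * R (ρ x)) * u₁ x).im = ω := by
  have ha : |a| < M := hsub
  refine ⟨?_, ?_, fun x ↦ ?_⟩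
  · have h : Tendsto (fun x ↦ Real.sqrt (ρ x ^ 2 + a ^ 2) * ‖R (ρ x)‖) atTop (𝓝 1) :=
      (tendsto_norm_infinitySolution (a := a) hn).comp hρ.tendsto_atTop
    exact h.congr fun x ↦ (norm_sqrt_weight_mul a (ρ x) (R (ρ x))).symm
  · have h : Tendsto (fun x ↦ delta M a (ρ x) / (ρ x ^ 2 + a ^ 2) *
        ‖deriv (fun s : ℝ ↦ ((Real.sqrt (s ^ 2 + a ^ 2) : ℝ) : ℂ) * R s) (ρ x)‖) atTop
        (𝓝 |ω|) :=
      (tendsto_norm_deriv_infinitySolution hM ha hω hR hn).comp hρ.tendsto_atTop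
    refine h.congr fun x ↦ ?_
    rw [hu₁ x, norm_mul, Complex.norm_of_nonneg (hρ.deriv_pos hsub x).le]
  · obtain ⟨R', R'', hd⟩ := id hR
    have hr := hρ.rPlus_lt x
    have hA := hρ.sq_add_sq_pos hsub x
    rw [hu₁ x, im_conj_weight_mul_deriv a _ hA (hd _ hr).1.differentiableAt,
      div_mul_cancel₀ _ hA.ne', radialFlux_eq_of_normalisedInfinity hM ha hω hR hn hr]

/-! ### The reduction -/

-- adapted from Summits/FinalStateConjecture/FinalStateConjecture/Theorems/PhaseMixingCaptureKappaExplicitWaveDecayPolyPlumbing.lean (`stub_polyPlumbing` (A))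
/-- **The `R`-language cone kernel bound from its tortoise-variable core, `Λ`-dependent regime,
pointwise constants.** Fix `M > 0`, `θ > 0`, constants `a₁ < M`, `ε₀ > 0`, `C`, `N`, and a regime
`P a ω m Λ` invariant under `(ω, m) ↦ (−ω, −m)`. Suppose the CORE: for all `a₁ ≤ |a| < M`, admissible
`(ω, m, Λ)` with `0 < m`, `|ω − mω₊| ≤ ε₀|m|`, `P a ω m Λ`, every tortoise radius `ρ`, every pair
`u_𝓗, u_𝓘` of solutions of `u″ + (ω² − V(ρ x))u = 0` with the horizon data (`‖u_𝓗‖ → 1`,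
`‖u_𝓗′‖ → |ω − mω₊|`, flux `−(ω − mω₊)`) and infinity data (`‖u_𝓘‖ → 1`, `‖u_𝓘′‖ → |ω|`, flux `ω`),
and all `x ≤ x′` with `ρ x′ ≥ r₊ + θ(r₊ − r₋)`:
`‖u_𝓗 x‖‖u_𝓘 x′‖ ≤ CΛ^Nκ^{-N}‖u_𝓗 u_𝓘′ − u_𝓘 u_𝓗′‖(x)`. Then with `a₂ = a₁ ⊔ M/2`,
`ε₂ = ε₀ ⊓ a₂/(8M²)`: for all `a₂ ≤ |a| < M`, admissible `(ω, m, Λ)` with `m ≠ 0`,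
`|ω − mω₊| ≤ ε₂|m|`, `P a ω m Λ`, all normalised `R_𝓗, R_𝓘` and `r₊ < r ≤ r′`,
`r′ ≥ r₊ + θ(r₊ − r₋)`: `√(r²+a²)‖R_𝓗 r‖·√(r′²+a²)‖R_𝓘 r′‖ ≤ CΛ^Nκ^{-N}‖𝔚(r)‖`. [folklore] -/
theorem kernelBound_of_tortoise_core_regime {M θ a₁ ε₀ C : ℝ} {N : ℕ} (hM : 0 < M)
    (ha₁ : a₁ < M) (hε₀ : 0 < ε₀) (P : ℝ → ℝ → ℤ → ℝ → Prop)
    (hP : ∀ a ω m Λ, P a ω m Λ → P a (-ω) (-m) Λ)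
    (hcore : ∀ a : ℝ, a₁ ≤ |a| → IsSubextremal M a →
        ∀ (ω : ℝ) (m : ℤ) (Λ : ℝ), IsAdmissibleTriple a ω m Λ → 0 < m →
          |ω - m * horizonAngularVelocity M a| ≤ ε₀ * |(m : ℝ)| → P a ω m Λ →
            ∀ ρ : ℝ → ℝ, IsTortoiseRadius M a ρ →
            ∀ uH uH₁ uI uI₁ : ℝ → ℂ,
              (∀ x, HasDerivAt uH (uH₁ x) x ∧
                HasDerivAt uH₁ (-(((ω ^ 2 - sepPotential M a ω m Λ (ρ x) : ℝ) : ℂ) * uH x)) x) →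
              (∀ x, HasDerivAt uI (uI₁ x) x ∧
                HasDerivAt uI₁ (-(((ω ^ 2 - sepPotential M a ω m Λ (ρ x) : ℝ) : ℂ) * uI x)) x) →
              Tendsto (fun x ↦ ‖uH x‖) atBot (𝓝 1) →
              Tendsto (fun x ↦ ‖uH₁ x‖) atBot (𝓝 |ω - m * horizonAngularVelocity M a|) →
              (∀ x, (starRingEnd ℂ (uH x) * uH₁ x).im = -(ω - m * horizonAngularVelocity M a)) →
              Tendsto (fun x ↦ ‖uI x‖) atTop (𝓝 1) →
              Tendsto (fun x ↦ ‖uI₁ x‖) atTop (𝓝 |ω|) →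
              (∀ x, (starRingEnd ℂ (uI x) * uI₁ x).im = ω) →
                ∀ x x' : ℝ, x ≤ x' → rPlus M a + θ * (rPlus M a - rMinus M a) ≤ ρ x' →
                  ‖uH x‖ * ‖uI x'‖ ≤
                    C * Λ ^ N * (surfaceGravity M a)⁻¹ ^ N * ‖uH x * uI₁ x - uI x * uH₁ x‖) :
    ∃ a₂ ε₂ : ℝ, a₂ < M ∧ 0 < ε₂ ∧ a₁ ≤ a₂ ∧ ε₂ ≤ ε₀ ∧
      ∀ a : ℝ, a₂ ≤ |a| → IsSubextremal M a →
        ∀ (ω : ℝ) (m : ℤ) (Λ : ℝ), IsAdmissibleTriple a ω m Λ → m ≠ 0 →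
          |ω - m * horizonAngularVelocity M a| ≤ ε₂ * |(m : ℝ)| → P a ω m Λ →
            ∀ RH RI : ℝ → ℂ,
              IsRadialTeukolskySolution M a 0 ω m (Λ - a ^ 2 * ω ^ 2) RH →
              IsNormalisedHorizonSolution M a 0 ω m RH →
              IsRadialTeukolskySolution M a 0 ω m (Λ - a ^ 2 * ω ^ 2) RI →
              IsNormalisedInfinitySolution M 0 ω RI →
                ∀ r r' : ℝ, rPlus M a < r → r ≤ r' →
                  rPlus M a + θ * (rPlus M a - rMinus M a) ≤ r' →
                    Real.sqrt (r ^ 2 + a ^ 2) * ‖RH r‖ * (Real.sqrt (r' ^ 2 + a ^ 2) * ‖RI r'‖) ≤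
                      C * Λ ^ N * (surfaceGravity M a)⁻¹ ^ N * ‖radialWronskian M a 0 RH RI r‖ := by
  -- shrink the constants so that `ω ≠ 0` in the cone
  obtain ⟨a₂, ε₂, ha₂, hε₂, ha₁₂, hε₂₀, hω₂⟩ := cone_constants_omega_ne_zero hM ha₁ hε₀
  refine ⟨a₂, ε₂, ha₂, hε₂, ha₁₂, hε₂₀, ?_⟩
  -- WLOG `0 < m`
  refine coneKernelBound_of_pos_regime P hP fun a ha hsub ω m Λ hadm hm hcone hPw RH RI hH hnH hI
    hnI r r' hr hrr' hr' ↦ ?_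
  have ha' : |a| < M := hsub
  have hω : ω ≠ 0 := hω₂ a ω m ha hm.ne' hcone
  have ha₁a : a₁ ≤ |a| := ha₁₂.trans ha
  have hcone' : |ω - m * horizonAngularVelocity M a| ≤ ε₀ * |(m : ℝ)| :=
    hcone.trans (mul_le_mul_of_nonneg_right hε₂₀ (abs_nonneg _))
  -- Carter's variable: a tortoise radius `ρ`, `r = ρ x`, `r' = ρ x'`, `x ≤ x'`
  obtain ⟨ρ, hρ⟩ := exists_isTortoiseRadius hsub
  obtain ⟨x, rfl⟩ := hρ.exists_apply_eq hr
  obtain ⟨x', rfl⟩ := hρ.exists_apply_eq (hr.trans_le hrr')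
  have hxx' : x ≤ x' := (hρ.strictMono hsub).le_iff_le.1 hrr'
  -- `u = √(ρ² + a²)·R ∘ ρ`, its tortoise derivative, and the end data
  obtain ⟨uH₁, hduH, huH₁⟩ := carter_equation_of_radial hM ha' hH hρ
  obtain ⟨uI₁, hduI, huI₁⟩ := carter_equation_of_radial hM ha' hI hρ
  obtain ⟨hlimH, hlimH₁, hfluxH⟩ := horizon_data_of_radial hM hsub hH hnH hρ huH₁
  obtain ⟨hlimI, hlimI₁, hfluxI⟩ := infinity_data_of_radial hM hsub hω hI hnI hρ huI₁
  -- the core bound at `(x, x')`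
  have key : ‖((Real.sqrt (ρ x ^ 2 + a ^ 2) : ℝ) : ℂ) * RH (ρ x)‖ *
      ‖((Real.sqrt (ρ x' ^ 2 + a ^ 2) : ℝ) : ℂ) * RI (ρ x')‖ ≤
      C * Λ ^ N * (surfaceGravity M a)⁻¹ ^ N *
        ‖((Real.sqrt (ρ x ^ 2 + a ^ 2) : ℝ) : ℂ) * RH (ρ x) * uI₁ x -
          ((Real.sqrt (ρ x ^ 2 + a ^ 2) : ℝ) : ℂ) * RI (ρ x) * uH₁ x‖ :=
    hcore a ha₁a hsub ω m Λ hadm hm hcone' hPw ρ hρ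
      (fun y ↦ ((Real.sqrt (ρ y ^ 2 + a ^ 2) : ℝ) : ℂ) * RH (ρ y)) uH₁
      (fun y ↦ ((Real.sqrt (ρ y ^ 2 + a ^ 2) : ℝ) : ℂ) * RI (ρ y)) uI₁
      hduH hduI hlimH hlimH₁ hfluxH hlimI hlimI₁ hfluxI x x' hxx' hr'
  -- back to `R`: `‖u‖ = √(r² + a²)‖R‖` and `u_𝓗 u_𝓘′ − u_𝓘 u_𝓗′ = 𝔚`
  have hdH : DifferentiableAt ℝ RH (ρ x) := by
    obtain ⟨R', R'', hd⟩ := hH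
    exact (hd _ (hρ.rPlus_lt x)).1.differentiableAt
  have hdI : DifferentiableAt ℝ RI (ρ x) := by
    obtain ⟨R', R'', hd⟩ := hI
    exact (hd _ (hρ.rPlus_lt x)).1.differentiableAt
  rw [norm_sqrt_weight_mul, norm_sqrt_weight_mul, huH₁ x, huI₁ x,
    wronskian_schrodingerForm ha' hρ hdH hdI] at key
  exact key

end Costa2019

end Literature.Geometry.Lorentzian.Kerr

end
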